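import Summits.CriticalPhenomena.CardyFormulaZ2.Theorems.CardyIKTransportCornerLineDescentCrudeContinuity3
import Literature.Probability.Percolation.RSW
import Literature.Probability.Percolation.QuadCrossingContinuityOfLemma51

/-!
# The frozen end's continuity statement from Schramm–Smirnov's Lemma 5.1 (the bridge)

Support file (part 3 of 3) for the registered stub
`stub_CrudeCrossingContinuity : ∀ R, Freeze.CrudeCrossingContinuity R` of the line `symmetric-seed-second-order` of
the crux `CardyIKTransport.CornerLineDescent` (stmt-CriticalPhenomena-10964) — the one open statement of the frozen
end `p = 0` of the corner line after `stub_FreezeHomogenisation_of_continuity` (`…FreezeHomogenisation.lean`).  This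
file REDUCES it to a named fact of the literature already in the tree:

* `Freeze.crudeCrossingContinuity_of_discrete` — `CrudeCrossingContinuity R` for every conformal rectangle `R` from
  Schramm–Smirnov's discrete continuity estimate (5.1) for critical bond percolation on `δℤ²` (hypothesis spelled out
  in the raw form delivered by `QuadCrossing.Quad.continuity_of_lemma_5_1` and by
  `QuadCrossing.Quad.continuity_of_bound` at `D = univ`: for every quad `Q₀` of the plane and `ε > 0` there are
  `Q' < Q₀ < Q''` and `δ₀ > 0` with
  `P_{1/2}[Q' crossed inside the open edges ∧ Q'' not] ≤ ε` for `0 < δ < δ₀`).  Proof: read `R` as the model chart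
  quad `Q₀ = Ψ([-1,1]²)` of its transposed square model (part 1); `Q' < Q₀` and `Q₀ < Q''` are open conditions in the
  uniform metric, so `Q'` is dominated by the short fat quad `fatQuad Ψ s` and the long thin quad `thinQuad Ψ t s`
  dominates `Q''` once `s, t` are small (`Freeze.dist_chartQuad_le`, uniform continuity of `Ψ` on `[-2,2]²`); the
  upper inclusion (part 1) and the lower inclusion (part 2) then squeeze `upperCrossing ∖ lowerCrossing` into the (5.1)
  event up to the null set of non-lattice configurations, for all meshes `δ√2 < δ₀` below the two gaps.
* `Freeze.crudeCrossingContinuity_of_lemma_5_1` and the anchor `stub_CrudeCrossingContinuity_of_SS` — the same from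
  the named fact `SchrammSmirnov2011_lemma_5_1` (`QuadCrossingContinuityEvents.lean`; O. Schramm, S. Smirnov, Ann.
  Probab. 39 (2011), Lemma 5.1: crossing events of subsequential scaling limits have null boundary; UNDISCHARGED in
  the tree, itself reduced there to the scale-free form of their Lemma 6.1, `SchrammSmirnov2011_lemma_5_1_of_bound`).

So the stub, and with it `stub_FreezeHomogenisation`, hold conditionally on exactly `SchrammSmirnov2011_lemma_5_1`.
Everything here is proved; no named fact is introduced.
References: Schramm–Smirnov, Ann. Probab. 39 (2011) 1768–1814, §1.3, Lemma 5.1 and eq. (5.1), Lemma 6.1; route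
file `Theses/CardyIKTransport.lean` (items 10964, 4967).
-/

noncomputable section

namespace Summit.CriticalPhenomena.CardyFormulaZ2.Theorems.CornerLineDescent.SymmetricSeed

open scoped Topology unitInterval ENNReal
open Filter Set Function Metric MeasureTheory
open Literature.Probability.Percolation (IsSquareModel exists_isSquareModel unitSquareQuad unitSquareQuad_carrier
  BondConfig openEdgeUnion mem_openEdgeUnion_iff openCrossing openConnIn bondPercolation half)
open Literature.Probability.Percolation.QuadCrossing (Quad)
open Literature.Probability.Percolation.QuadCrossing.Quad (rectChart rectChart_re_im continuous_rectChart
  rectChart_injective carrier_eq_of_chart side_zero_eq_of_chart side_two_eq_of_chart Dominated StrictlyDominated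
  strictlyDominated_iff)
open Literature.Probability.LatticeModels
open Literature.Probability.RandomPlanarGeometry

namespace Freeze

/-! ## Chart quads of nearby rectangles are uniformly close -/

/-- A convex combination `u(1-s) + vs`, `s ∈ [0,1]`, is bounded by `|u| + |v|` in absolute value. [folklore] -/
theorem abs_convex_comb_le {u v s : ℝ} (hs0 : 0 ≤ s) (hs1 : s ≤ 1) : |u * (1 - s) + v * s| ≤ |u| + |v| := by
  calc |u * (1 - s) + v * s| ≤ |u * (1 - s)| + |v * s| := abs_add_le _ _
    _ = |u| * (1 - s) + |v| * s := by rw [abs_mul, abs_mul, abs_of_nonneg (sub_nonneg.2 hs1), abs_of_nonneg hs0]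
    _ ≤ |u| + |v| := by nlinarith [abs_nonneg u, abs_nonneg v]

/-- CHART QUADS OF NEARBY RECTANGLES ARE UNIFORMLY CLOSE TO THE MODEL QUAD `Ψ([-1,1]²)`: if `Ψ` moves `θ`-close
points of `[-2,2]²` to `r`-close points and the four coordinates of the rectangle (inside `[-2, 2]`) differ
from `∓1` by a total of at most `θ`, the two chart quads are at uniform distance `≤ r`. [folklore] -/
theorem dist_chartQuad_le {Ψ : ℂ ≃ₜ ℂ} {θ r : ℝ} (hr : 0 ≤ r)
    (hΨ : ∀ a ∈ Icc (-2 : ℝ) 2 ×ℂ Icc (-2 : ℝ) 2, ∀ b ∈ Icc (-2 : ℝ) 2 ×ℂ Icc (-2 : ℝ) 2,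
      dist a b ≤ θ → dist (Ψ a) (Ψ b) ≤ r)
    {x₀ x₁ y₀ y₁ : ℝ} (hx : x₀ < x₁) (hy : y₀ < y₁) (hx₀ : x₀ ∈ Icc (-2 : ℝ) 2) (hx₁ : x₁ ∈ Icc (-2 : ℝ) 2)
    (hy₀ : y₀ ∈ Icc (-2 : ℝ) 2) (hy₁ : y₁ ∈ Icc (-2 : ℝ) 2) (hθ : |x₀ + 1| + |x₁ - 1| + (|y₀ + 1| + |y₁ - 1|) ≤ θ) :
    dist (chartQuad Ψ x₀ x₁ y₀ y₁ hx hy) (chartQuad Ψ (-1) 1 (-1) 1 (by norm_num) (by norm_num)) ≤ r := by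
  rw [Quad.dist_eq, ContinuousMap.dist_le hr]
  intro p
  have hs0 : (0 : ℝ) ≤ p.1 := p.1.2.1
  have hs1 : (p.1 : ℝ) ≤ 1 := p.1.2.2
  have ht0 : (0 : ℝ) ≤ p.2 := p.2.2.1
  have ht1 : (p.2 : ℝ) ≤ 1 := p.2.2.2
  obtain ⟨e1, e2⟩ := rectChart_re_im x₀ x₁ y₀ y₁ p
  obtain ⟨f1, f2⟩ := rectChart_re_im (-1) 1 (-1) 1 p
  refine hΨ _ ?_ _ ?_ ?_
  · rw [Complex.mem_reProdIm, e1, e2]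
    constructor <;> constructor <;> nlinarith [hx₀.1, hx₀.2, hx₁.1, hx₁.2, hy₀.1, hy₀.2, hy₁.1, hy₁.2]
  · rw [Complex.mem_reProdIm, f1, f2]
    constructor <;> constructor <;> nlinarith
  · rw [dist_eq_norm]
    refine (Complex.norm_le_abs_re_add_abs_im _).trans ?_
    rw [Complex.sub_re, Complex.sub_im, e1, e2, f1, f2]
    have hre : x₀ + (x₁ - x₀) * (p.1 : ℝ) - (-1 + (1 - -1) * (p.1 : ℝ)) = (x₀ + 1) * (1 - p.1) + (x₁ - 1) * p.1 := by
      ring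
    have him : y₀ + (y₁ - y₀) * (p.2 : ℝ) - (-1 + (1 - -1) * (p.2 : ℝ)) = (y₀ + 1) * (1 - p.2) + (y₁ - 1) * p.2 := by
      ring
    rw [hre, him]
    linarith [abs_convex_comb_le (u := x₀ + 1) (v := x₁ - 1) hs0 hs1,
      abs_convex_comb_le (u := y₀ + 1) (v := y₁ - 1) ht0 ht1]

/-! ## Domination radii from Schramm–Smirnov's strict order -/

/-- From `Q' < Q₀`: every quad uniformly close to `Q₀` is dominated by `Q'` (every one of its crossings contains a
crossing of `Q'`). [folklore] -/
theorem exists_radius_left {Q' Q₀ : Quad (univ : Set ℂ)} (h : StrictlyDominated Q' Q₀) :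
    ∃ r : ℝ, 0 < r ∧ ∀ P : Quad (univ : Set ℂ), dist P Q₀ < r → Dominated Q' P := by
  obtain ⟨U₁, U₂, -, hU₂, h₁, h₂, hdom⟩ := strictlyDominated_iff.1 h
  obtain ⟨r, hr, hball⟩ := Metric.isOpen_iff.1 hU₂ Q₀ h₂
  exact ⟨r, hr, fun P hP => hdom Q' h₁ P (hball hP)⟩

/-- From `Q₀ < Q''`: every quad uniformly close to `Q₀` dominates `Q''`. [folklore] -/
theorem exists_radius_right {Q₀ Q'' : Quad (univ : Set ℂ)} (h : StrictlyDominated Q₀ Q'') :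
    ∃ r : ℝ, 0 < r ∧ ∀ P : Quad (univ : Set ℂ), dist P Q₀ < r → Dominated P Q'' := by
  obtain ⟨U₁, U₂, hU₁, -, h₁, h₂, hdom⟩ := strictlyDominated_iff.1 h
  obtain ⟨r, hr, hball⟩ := Metric.isOpen_iff.1 hU₁ Q₀ h₁
  exact ⟨r, hr, fun P hP => hdom P (hball hP) Q'' h₂⟩

/-! ## Assembly: the continuity statement from Schramm–Smirnov's discrete estimate (5.1) -/

/-- THE BRIDGE FROM (5.1).  If critical bond percolation on `δℤ²` satisfies Schramm–Smirnov's discrete continuity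
estimate (5.1) for every quad of the plane — for every `Q₀` and `ε > 0` there are `Q' < Q₀ < Q''` and `δ₀ > 0` with
`P_{1/2}[Q' crossed inside the open edges ∧ Q'' not] ≤ ε` for `0 < δ < δ₀` (the conclusion of the tree's
`Quad.continuity_of_lemma_5_1`, and of `Quad.continuity_of_uniform` at `D = univ`) — then the crude bond-`ℤ²`
crossing probabilities of every conformal rectangle are mesh-uniformly continuous in the discretisation of the
domain (`CrudeCrossingContinuity`).  Proof: read `R` as the chart quad `Q₀ = Ψ([-1,1]²)` of its transposed
square model; the fattened event is a crossing of the short fat chart quad `Ψ([-1+s,1-s] × [-1-s,1+s])`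
(`exists_upper_gap`), which is dominated by `Q'` for `s` small (`Q' < Q₀` is open); every crossing of `Q''`
contains one of the long thin chart quad `Ψ([-1-t,1+t] × [-1+s,1-s])` (`Q₀ < Q''`), which yields the thinned
collar-to-collar event (`exists_lower_data`); lattice configurations have full measure. [folklore] -/
theorem crudeCrossingContinuity_of_discrete
    (h51 : ∀ (Q₀ : Quad (univ : Set ℂ)) (ε : ℝ≥0∞), 0 < ε →
      ∃ Q' Q'' : Quad (univ : Set ℂ), StrictlyDominated Q' Q₀ ∧ StrictlyDominated Q₀ Q'' ∧
        ∃ δ₀ : ℝ, 0 < δ₀ ∧ ∀ δ : ℝ, 0 < δ → δ < δ₀ →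
          bondPercolation (zdGraph 2) half
            {ω | (∃ K, Q'.IsCrossing K ∧ K ⊆ openEdgeUnion δ ω) ∧
              ¬ ∃ K, Q''.IsCrossing K ∧ K ⊆ openEdgeUnion δ ω} ≤ ε)
    (R : ConformalRectangle) : CrudeCrossingContinuity R := by
  intro ε hε
  obtain ⟨Φ, hΦ⟩ := exists_isSquareModel R
  set Ψ := tmodel Φ with hΨ
  obtain ⟨Q', Q'', hQ', hQ'', δ₀, hδ₀, hE⟩ :=
    h51 (chartQuad Ψ (-1) 1 (-1) 1 (by norm_num) (by norm_num)) (ENNReal.ofReal ε) (ENNReal.ofReal_pos.2 hε)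
  obtain ⟨r₁, hr₁, hdom₁⟩ := exists_radius_left hQ'
  obtain ⟨r₂, hr₂, hdom₂⟩ := exists_radius_right hQ''
  have hr₁₂ : 0 < min r₁ r₂ / 2 := half_pos (lt_min hr₁ hr₂)
  obtain ⟨θ, hθ, hmod⟩ := exists_modulus Ψ hr₁₂
  set s : ℝ := min (1 / 2) (θ / 4) with hsdef
  have hs : 0 < s := lt_min one_half_pos (by positivity)
  have hs1 : s ≤ 1 / 2 := min_le_left _ _
  have hsθ : 4 * s ≤ θ := by rw [hsdef]; linarith [min_le_right (1 / 2 : ℝ) (θ / 4)]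
  obtain ⟨g, hg, hup⟩ := exists_upper_gap hΦ hs hs1
  obtain ⟨t, ht, hts, κ, hκ, r, hr, hlow⟩ := exists_lower_data hΦ hs hs1 hs
  -- domination of the two chart quads
  have hdomP : Dominated Q' (fatQuad Ψ s) := by
    rw [fatQuad_eq _ hs (by linarith)]
    refine hdom₁ _ ((dist_chartQuad_le hr₁₂.le hmod _ _ ⟨by linarith, by linarith⟩ ⟨by linarith, by linarith⟩
      ⟨by linarith, by linarith⟩ ⟨by linarith, by linarith⟩ ?_).trans_lt ?_)
    · have e1 : -1 + s + 1 = s := by ring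
      have e2 : 1 - s - 1 = -s := by ring
      have e3 : -1 - s + 1 = -s := by ring
      have e4 : 1 + s - 1 = s := by ring
      rw [e1, e2, e3, e4, abs_neg, abs_of_pos hs]
      linarith
    · linarith [min_le_left r₁ r₂]
  have hdomM : Dominated (thinQuad Ψ t s) Q'' := by
    rw [thinQuad_eq _ ht hs (by linarith)]
    refine hdom₂ _ ((dist_chartQuad_le hr₁₂.le hmod _ _ ⟨by linarith, by linarith⟩ ⟨by linarith, by linarith⟩
      ⟨by linarith, by linarith⟩ ⟨by linarith, by linarith⟩ ?_).trans_lt ?_)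
    · have e1 : -1 - t + 1 = -t := by ring
      have e2 : 1 + t - 1 = t := by ring
      have e3 : -1 + s + 1 = s := by ring
      have e4 : 1 - s - 1 = -s := by ring
      rw [e1, e2, e3, e4, abs_neg, abs_neg, abs_of_pos hs, abs_of_pos ht]
      linarith
    · linarith [min_le_right r₁ r₂]
  -- the radius and the meshes
  refine ⟨κ, hκ, min g r / 2, by positivity, ?_⟩
  have hev : ∀ᶠ δ in 𝓝[>] (0 : ℝ), δ ∈ Ioo (0 : ℝ) (min (min g r / 4) (δ₀ / 2)) :=
    Ioo_mem_nhdsGT (by positivity)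
  filter_upwards [hev] with δ hδ
  rw [mem_Ioo] at hδ
  obtain ⟨hδ, hδ'⟩ := hδ
  have hδgr : δ < min g r / 4 := hδ'.trans_le (min_le_left _ _)
  have hδδ₀ : δ < δ₀ / 2 := hδ'.trans_le (min_le_right _ _)
  have hsq2 : Real.sqrt 2 < 2 := by linarith [Real.sqrt_two_lt_three_halves]
  have hm2 : δ * Real.sqrt 2 < 2 * δ := by nlinarith
  have hmpos : 0 < δ * Real.sqrt 2 := by positivity
  have hmδ₀ : δ * Real.sqrt 2 < δ₀ := by linarith
  have hmg : δ * Real.sqrt 2 + min g r / 2 ≤ g := by linarith [min_le_left g r]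
  have hmr : δ * Real.sqrt 2 + min g r / 2 ≤ r := by linarith [min_le_right g r]
  have hρ : 0 ≤ min g r / 2 := by positivity
  set ρ : ℝ := min g r / 2 with hρdef
  set m : ℝ := δ * Real.sqrt 2 with hm
  set P := bondPercolation (zdGraph 2) half with hP
  set E : Set (BondConfig (Site 2)) := {ω | (∃ K, Q'.IsCrossing K ∧ K ⊆ openEdgeUnion m ω) ∧
    ¬ ∃ K, Q''.IsCrossing K ∧ K ⊆ openEdgeUnion m ω} with hEdef
  set G : Set (BondConfig (Site 2)) := {ω | ω ⊆ (zdGraph 2).edgeSet} with hGdef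
  -- the inclusion of events
  have hincl : upperCrossing R ρ δ ⊆ lowerCrossing R κ ρ δ ∪ (E ∪ Gᶜ) := by
    intro ω hωup
    by_cases hωG : ω ⊆ (zdGraph 2).edgeSet
    swap
    · exact Or.inr (Or.inr hωG)
    by_cases hlowK : ∃ K, Q''.IsCrossing K ∧ K ⊆ openEdgeUnion m ω
    · obtain ⟨K, hK, hKO⟩ := hlowK
      obtain ⟨K', hK'K, hK'⟩ := hdomM K hK
      exact Or.inl (hlow δ ρ hδ hρ hmr ω K' hK' (hK'K.trans hKO))
    · obtain ⟨K, hK, hKO⟩ := hup δ ρ hδ hρ hmg ω hωG hωup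
      obtain ⟨K', hK'K, hK'⟩ := hdomP K hK
      exact Or.inr (Or.inl ⟨⟨K', hK', hK'K.trans hKO⟩, hlowK⟩)
  -- the measures
  have hGc : P.real Gᶜ = 0 := by
    rw [measureReal_def, ENNReal.toReal_eq_zero_iff]
    left
    have hae := Literature.Probability.Percolation.ae_subset_edgeSet (zdGraph 2) half
    rw [Filter.Eventually, MeasureTheory.mem_ae_iff] at hae
    exact hae
  have hEε : P.real E ≤ ε := ENNReal.toReal_le_of_le_ofReal hε.le (hE m hmpos hmδ₀)
  calc P.real (upperCrossing R ρ δ) ≤ P.real (lowerCrossing R κ ρ δ ∪ (E ∪ Gᶜ)) := measureReal_mono hincl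
    _ ≤ P.real (lowerCrossing R κ ρ δ) + P.real (E ∪ Gᶜ) := measureReal_union_le _ _
    _ ≤ P.real (lowerCrossing R κ ρ δ) + (P.real E + P.real Gᶜ) := by
        gcongr
        exact measureReal_union_le _ _
    _ ≤ P.real (lowerCrossing R κ ρ δ) + ε := by rw [hGc, add_zero]; gcongr

/-- THE BRIDGE FROM THE NAMED FACT.  Schramm–Smirnov's Lemma 5.1 (`SchrammSmirnov2011_lemma_5_1`: the crossing
events of subsequential scaling limits of critical bond percolation on `δℤ²` have null topological boundary)
implies the continuity statement `CrudeCrossingContinuity R` for every conformal rectangle, through the tree's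
converse `Quad.continuity_of_lemma_5_1` (Lemma 5.1 ⇒ (5.1)) and `crudeCrossingContinuity_of_discrete`.
[folklore] -/
theorem crudeCrossingContinuity_of_lemma_5_1
    (h51 : Literature.Probability.Percolation.QuadCrossing.SchrammSmirnov2011_lemma_5_1) (R : ConformalRectangle) :
    CrudeCrossingContinuity R :=
  crudeCrossingContinuity_of_discrete
    (fun Q₀ ε hε => Literature.Probability.Percolation.QuadCrossing.Quad.continuity_of_lemma_5_1 h51 Q₀ ε hε) R

end Freeze

/-- ANCHOR (registered sub-goal). THE FROZEN END'S ONE OPEN STATEMENT, REDUCED TO A NAMED FACT OF THE LITERATURE: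
Schramm–Smirnov 2011, Lemma 5.1 for critical bond percolation on `δℤ²` (the tree's named fact
`SchrammSmirnov2011_lemma_5_1`, undischarged) implies `Freeze.CrudeCrossingContinuity R` for every conformal
rectangle `R` — hence, with `stub_FreezeHomogenisation_of_continuity`, the registered stub
`stub_FreezeHomogenisation`. [folklore] -/
theorem stub_CrudeCrossingContinuity_of_SS : Literature.Probability.Percolation.QuadCrossing.SchrammSmirnov2011_lemma_5_1 → ∀ R : ConformalRectangle, Freeze.CrudeCrossingContinuity R :=
  fun h R => Freeze.crudeCrossingContinuity_of_lemma_5_1 h R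

end Summit.CriticalPhenomena.CardyFormulaZ2.Theorems.CornerLineDescent.SymmetricSeed
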